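import Summits.BirchSwinnertonDyer.Rank1Residual.AdditivePotMult.QuadraticBaseChangeMilneQuotientRankOne
import Summits.BirchSwinnertonDyer.Rank1Residual.AdditivePotMult.QuadraticBaseChangeMilneQuotientOddPartDischarge
import HarnessLib

/-!
# The A65-FREE base-change-and-descend ENDs in TOTAL RANK ONE: rank-one X3♯(M)/X4(M) pairs with a
# rank-zero twist (row T-MIL-R1, FILE E-3; seat n1011-p01 GEN 7)

HONEST FRAMING (cell `b2b-bsdres`, run/shared/lean/b2b/bsd-rank1-residual/, verbatim in every
file): the goal of the cell is to DELETE the COMBINATION-SHAPED residual classes of the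
Birch–Swinnerton-Dyer formula for ALL analytic-rank `≤ 1` elliptic curves over `ℚ` — "full BSD
formula for every rank `≤ 1` curve in class `C`" assembled STRICTLY from published theorems — so
that the rank-`≤ 1` remainder becomes exactly the CONSTRUCTION-SHAPED classes, which are TYPED
(missing-input `Prop`s), NOT attempted. This is not "finishing BSD". Sub-classes X3♯(M) / X4(M)
(additive, potentially multiplicative prime; base-change-and-descend): a RESEARCH ROUTE; they stay
CONSTRUCTION-SHAPED; nothing is booked by this file; no mark / label moved. THEOREMS ONLY: no
definition, no named fact, no `sorry`.

## What (row T-MIL-R1, `cells/n1011/skel/T-MIL-R1.md` §1 (E), FILE E-3)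

FILE D-2 (`QuadraticBaseChangeDescentOrdp`) gave the descent theorem with the `ord_p`-shaped Milne
binder `hWR_p` and no `Ш(W'/K)` hypothesis, and its A65-free ENDs in RANK ZERO. FILE E-2
(`QuadraticBaseChangeMilneQuotientRankOne`) reduced `hWR_p` in TOTAL RANK ONE
(`rank W(ℚ) + rank Wd(ℚ) = 1`, imaginary `K`, odd `p`) to the odd Tamagawa identity, through
FILE E-1's regulator comparison `m·Reg(W') = 2·Reg(W)·Reg(Wd)`. This file plugs in row
T-MIL-ODD's ENDs #2 / #3 (the odd Tamagawa identity on S₁ / S₂) and composes: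

* `milneQuotient_ordp_of_semistable'_rankOne` / `milneQuotient_ordp_of_semistable_or_addv_rankOne`
  — `hWR_p` DISCHARGED in total rank one on S₁ (every odd `p`) / S₂ (`p ≥ 5`), FACT-FREE;
* `bsdp_of_pPartOver_of_bsdp_twist_rankOne_semistable` /
  `bsdp_of_pPartOver_of_bsdp_twist_rankOne_semistable_or_addv` — **THE A65-FREE DESCENT ENDs IN
  TOTAL RANK ONE**: for `W/ℚ`, `Wd = C_d • W^{(d_K)}`, `W' = C' • W_K` globally minimal, `K`
  IMAGINARY quadratic with `d_K` odd squarefree (e.g. `K = ℚ(√−p)`, `p ≡ 3 mod 4`),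
  **`W.analyticRank + Wd.analyticRank = 1`** — the cell's headline configuration: an X3♯(M)/X4(M)
  pair `(E, p)` with `r_an(E) = 1` and a twist `E^{(d_K)}` with `L(E^{(d_K)}, 1) ≠ 0` (or the
  `(0, 1)` configuration) — `W` on S₁ resp. S₂, `p` odd resp. `≥ 5`:
  **`BSDp W p ⟸ MissingPPartOverAt W' p ∧ BSDp Wd p`**, the ONLY other hypotheses being the cell's
  standing named facts `hGZK` (Gross–Zagier–Kolyvagin: rank and `Ш`-finiteness at analytic rank
  `≤ 1`) and `hmod`. NO Milne hypothesis (neither conjunct of A65), no `hshaK`, no `hWR`;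
* `bsdp_of_pPartOver_of_bsdp_twist_rankLeOne_semistable` / `…_or_addv` — the same with
  **`W.analyticRank + Wd.analyticRank ≤ 1`** (total rank `0`: FILE D-2's ENDs; total rank `1`: the
  above) — the form the class theorems (FILE E-4) and the real-quadratic file consume.

HONEST LIMITS: `K` imaginary, `d_K` odd squarefree, total analytic rank exactly `1`, odd `p`
(S₂: `p ≥ 5`); X3♯(M)/X4(M) stay CONSTRUCTION-SHAPED — the over-`K` input
`MissingPPartOverAt W' p` (now for a curve `E_K` of rank ONE, multiplicative at the prime above
`p` of ramification index `2`) is untouched and is the located gap; `ClassTheorems` / `Descent` are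
NOT edited; TOOL theorems; closes no class; moves no mark.

References: J. S. Milne, Invent. Math. 17 (1972) §1 Thm. 1, §2 [Milne1972ArithmeticAV];
T. Dokchitser, V. Dokchitser, Ann. of Math. 172 (2010) §2.1 [DokchitserDokchitserAnnals2010];
B. Gross, D. Zagier, Invent. Math. 84 (1986) V.§2 [GrossZagier1986]; R. L. Miller, LMS J.
Comput. Math. 14 (2011) Def. 1.1 [Miller2011LMS].
-/

noncomputable section

open scoped Classical NumberField

open WeierstrassCurve NumberField IsDedekindDomain Rat.HeightOneSpectrum
  Literature.NumberTheory.EllipticCurves Literature.NumberTheory.EllipticCurves.Rank1Residual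
  Literature.NumberTheory.EllipticCurves.Rank1Residual.Typed

namespace Summit.BirchSwinnertonDyer.Rank1Residual.AdditivePotMult

section RankOneEnds

variable (W : WeierstrassCurve ℚ) [W.IsElliptic] [W.IsGloballyMinimal] (p : ℕ) [hp : Fact p.Prime]
  (K : Type) [Field K] [NumberField K] [IsTotallyComplex K]
  (Wd : WeierstrassCurve ℚ) [Wd.IsElliptic] [Wd.IsGloballyMinimal]
  (W' : WeierstrassCurve K) [W'.IsElliptic] [W'.IsGloballyMinimal]

/-- **DISCHARGE of `hWR_p` in TOTAL RANK ONE on S₁, EVERY ODD `p`, imaginary `K`, FACT-FREE**: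
`W/ℚ`, `Wd = C_d • W^{(d_K)}`, `W' = C' • W_K` globally minimal, `d_K` odd squarefree,
`rank W(ℚ) + rank Wd(ℚ) = 1`, `Ш(W)`, `Ш(Wd)` finite, `W` on S₁ (good ∨ multiplicative ∨
(`ℓ ∣ d_K` ∧ `Wd` multiplicative) at every place): `hWR_p` at `p` — FILE E-2
`milneQuotient_ordp_of_tamagawa_of_rank_add_eq_one` fed with END #2
(`padicValRat_norm_mul_tamagawaProduct_eq_of_semistable'`, FILE C-3f).
[cite: Milne1972ArithmeticAV, §1 Thm. 1 and §2 (through DokchitserDokchitserAnnals2010, §2.1, proof of Thm. 8)] -/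
theorem milneQuotient_ordp_of_semistable'_rankOne (h2 : Module.finrank ℚ K = 2)
    (hdodd : Odd (NumberField.discr K)) (hdsq : Squarefree (NumberField.discr K))
    {Cd : VariableChange ℚ} (hWd : Cd • W.quadraticTwist (NumberField.discr K : ℚ) = Wd)
    {C' : VariableChange K} (hW' : C' • W.baseChange K = W') [Finite W.sha] [Finite Wd.sha]
    (hr : W.mordellWeilRank + Wd.mordellWeilRank = 1)
    (hS : ∀ v : HeightOneSpectrum (𝓞 ℚ), W.HasGoodReductionAt v ∨ W.HasMultiplicativeReductionAt v ∨
      (((primesEquiv v : ℕ) : ℤ) ∣ NumberField.discr K ∧ Wd.HasMultiplicativeReductionAt v))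
    (hp2 : p ≠ 2) :
    ∃ q : ℚ, 0 < q ∧ padicValRat p q = 0 ∧
      (W'.shaOrder : ℝ) * W'.regulator * W'.bsdPeriod * (W'.tamagawaProduct : ℝ) /
          (W'.torsionOrder : ℝ) ^ 2 = (q : ℝ) * (W.bsdRHS * Wd.bsdRHS) :=
  milneQuotient_ordp_of_tamagawa_of_rank_add_eq_one W K Wd W' h2 hWd hW' hr p hp2
    (padicValRat_norm_mul_tamagawaProduct_eq_of_semistable' W K Wd W' h2 hdodd hdsq hWd hW' hS p hp2)

/-- **DISCHARGE of `hWR_p` in TOTAL RANK ONE on S₂, `p ≥ 5`**: as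
`milneQuotient_ordp_of_semistable'_rankOne` with additive places of residue characteristic `≥ 5`
prime to `d_K` allowed in `hS` (END #3, `padicValRat_norm_mul_tamagawaProduct_eq_of_semistable_or_addv`,
FILE C-3g). Fact-free. [cite: Milne1972ArithmeticAV, §1 Thm. 1 and §2 (through DokchitserDokchitserAnnals2010, §2.1, proof of Thm. 8)] -/
theorem milneQuotient_ordp_of_semistable_or_addv_rankOne (h2 : Module.finrank ℚ K = 2)
    (hdodd : Odd (NumberField.discr K)) (hdsq : Squarefree (NumberField.discr K))
    {Cd : VariableChange ℚ} (hWd : Cd • W.quadraticTwist (NumberField.discr K : ℚ) = Wd)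
    {C' : VariableChange K} (hW' : C' • W.baseChange K = W') [Finite W.sha] [Finite Wd.sha]
    (hr : W.mordellWeilRank + Wd.mordellWeilRank = 1)
    (hS : ∀ v : HeightOneSpectrum (𝓞 ℚ), W.HasGoodReductionAt v ∨ W.HasMultiplicativeReductionAt v ∨
      (((primesEquiv v : ℕ) : ℤ) ∣ NumberField.discr K ∧ Wd.HasMultiplicativeReductionAt v) ∨
      (W.HasAdditiveReductionAt v ∧ ¬ ((primesEquiv v : ℕ) : ℤ) ∣ NumberField.discr K ∧
        5 ≤ (primesEquiv v : ℕ)))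
    (hp5 : 5 ≤ p) :
    ∃ q : ℚ, 0 < q ∧ padicValRat p q = 0 ∧
      (W'.shaOrder : ℝ) * W'.regulator * W'.bsdPeriod * (W'.tamagawaProduct : ℝ) /
          (W'.torsionOrder : ℝ) ^ 2 = (q : ℝ) * (W.bsdRHS * Wd.bsdRHS) :=
  milneQuotient_ordp_of_tamagawa_of_rank_add_eq_one W K Wd W' h2 hWd hW' hr p (by omega)
    (padicValRat_norm_mul_tamagawaProduct_eq_of_semistable_or_addv W K Wd W' h2 hdodd hdsq hWd hW'
      hS p hp5)

/-- **A65-FREE DESCENT END IN TOTAL RANK ONE on S₁, EVERY ODD `p`.** Let `W/ℚ` be globally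
minimal, `K` an IMAGINARY quadratic field with `d_K` odd squarefree (e.g. `K = ℚ(√−p)` for the
additive prime `p ≡ 3 mod 4` of an X3♯(M)/X4(M) pair), `Wd = C_d • W^{(d_K)}` and `W' = C' • W_K`
globally minimal, with **`r_an(W) + r_an(Wd) = 1`** (the rank-ONE pair with a twist of
non-vanishing `L`-value, or the `(0,1)` configuration), `W` on S₁ — at every place: good, or
multiplicative, or (`ℓ ∣ d_K` and `Wd` multiplicative there) — and `p` an odd prime. THEN
**`BSDp W p ⟸ MissingPPartOverAt W' p ∧ BSDp Wd p`**, the only further hypotheses being the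
cell's standing named facts `hGZK`, `hmod`. NO Milne hypothesis: `Ш(W'/K)` finite is the tree's
`shaFinite_baseChange_of_shaFinite` (inside D-2's `bsdp_of_pPartOver_of_bsdp_twist_ordp`); `hWR_p`
is `milneQuotient_ordp_of_semistable'_rankOne` (regulator comparison E-1, torsion / `Ш` odd parts
in any rank, archimedean comparison, odd Tamagawa identity END #2); ranks from `hGZK`.
[cite: Milne1972ArithmeticAV, §1 Thm. 1 and §2 (through DokchitserDokchitserAnnals2010, §2.1, proof of Thm. 8)]
[cite: GrossZagier1986, V.§2 (p. 311)] [cite: Miller2011LMS, Def. 1.1 (arXiv:1010.2431 p. 3)] -/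
theorem bsdp_of_pPartOver_of_bsdp_twist_rankOne_semistable
    (hGZK : rank_eq_analyticRank_of_analyticRank_le_one) (hmod : hasEntireLFunction_rat)
    (h2 : Module.finrank ℚ K = 2)
    (hdodd : Odd (NumberField.discr K)) (hdsq : Squarefree (NumberField.discr K))
    {Cd : VariableChange ℚ} (hWd : Cd • W.quadraticTwist (NumberField.discr K : ℚ) = Wd)
    {C' : VariableChange K} (hW' : C' • W.baseChange K = W')
    (hr : W.analyticRank + Wd.analyticRank = 1)
    (hS : ∀ v : HeightOneSpectrum (𝓞 ℚ), W.HasGoodReductionAt v ∨ W.HasMultiplicativeReductionAt v ∨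
      (((primesEquiv v : ℕ) : ℤ) ∣ NumberField.discr K ∧ Wd.HasMultiplicativeReductionAt v))
    (hp2 : p ≠ 2) (hK : MissingPPartOverAt W' p) (hd : BSDp Wd p) : BSDp W p := by
  have hr1 : W.analyticRank ≤ 1 := by omega
  have hrd1 : Wd.analyticRank ≤ 1 := by omega
  obtain ⟨hrankW, hfinW⟩ := hGZK W hr1
  obtain ⟨hrankD, hfinD⟩ := hGZK Wd hrd1
  haveI : Finite W.sha := hfinW
  haveI : Finite Wd.sha := hfinD
  have hrMW : W.mordellWeilRank + Wd.mordellWeilRank = 1 := by rw [hrankW, hrankD]; exact hr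
  exact bsdp_of_pPartOver_of_bsdp_twist_ordp W p K Wd W' hGZK hmod hr1 h2 ⟨Cd, hWd⟩ hrd1 ⟨C', hW'⟩
    (milneQuotient_ordp_of_semistable'_rankOne W p K Wd W' h2 hdodd hdsq hWd hW' hrMW hS hp2) hK hd

/-- **A65-FREE DESCENT END IN TOTAL RANK ONE on S₂, `p ≥ 5`.** As
`bsdp_of_pPartOver_of_bsdp_twist_rankOne_semistable` with ADDITIVE places of `W` of residue
characteristic `≥ 5` prime to `d_K` also allowed in `hS` (END #3), and `p ≥ 5`. No Milne
hypothesis; `hGZK`, `hmod` only. [cite: Milne1972ArithmeticAV, §1 Thm. 1 and §2 (through DokchitserDokchitserAnnals2010, §2.1, proof of Thm. 8)]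
[cite: GrossZagier1986, V.§2 (p. 311)] [cite: Miller2011LMS, Def. 1.1 (arXiv:1010.2431 p. 3)] -/
theorem bsdp_of_pPartOver_of_bsdp_twist_rankOne_semistable_or_addv
    (hGZK : rank_eq_analyticRank_of_analyticRank_le_one) (hmod : hasEntireLFunction_rat)
    (h2 : Module.finrank ℚ K = 2)
    (hdodd : Odd (NumberField.discr K)) (hdsq : Squarefree (NumberField.discr K))
    {Cd : VariableChange ℚ} (hWd : Cd • W.quadraticTwist (NumberField.discr K : ℚ) = Wd)
    {C' : VariableChange K} (hW' : C' • W.baseChange K = W')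
    (hr : W.analyticRank + Wd.analyticRank = 1)
    (hS : ∀ v : HeightOneSpectrum (𝓞 ℚ), W.HasGoodReductionAt v ∨ W.HasMultiplicativeReductionAt v ∨
      (((primesEquiv v : ℕ) : ℤ) ∣ NumberField.discr K ∧ Wd.HasMultiplicativeReductionAt v) ∨
      (W.HasAdditiveReductionAt v ∧ ¬ ((primesEquiv v : ℕ) : ℤ) ∣ NumberField.discr K ∧
        5 ≤ (primesEquiv v : ℕ)))
    (hp5 : 5 ≤ p) (hK : MissingPPartOverAt W' p) (hd : BSDp Wd p) : BSDp W p := by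
  have hr1 : W.analyticRank ≤ 1 := by omega
  have hrd1 : Wd.analyticRank ≤ 1 := by omega
  obtain ⟨hrankW, hfinW⟩ := hGZK W hr1
  obtain ⟨hrankD, hfinD⟩ := hGZK Wd hrd1
  haveI : Finite W.sha := hfinW
  haveI : Finite Wd.sha := hfinD
  have hrMW : W.mordellWeilRank + Wd.mordellWeilRank = 1 := by rw [hrankW, hrankD]; exact hr
  exact bsdp_of_pPartOver_of_bsdp_twist_ordp W p K Wd W' hGZK hmod hr1 h2 ⟨Cd, hWd⟩ hrd1 ⟨C', hW'⟩
    (milneQuotient_ordp_of_semistable_or_addv_rankOne W p K Wd W' h2 hdodd hdsq hWd hW' hrMW hS hp5)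
    hK hd

/-- **The A65-free descent END on S₁ in TOTAL ANALYTIC RANK `≤ 1`** (`r_an(W) + r_an(Wd) ≤ 1`):
total rank `0` by FILE D-2's `bsdp_of_pPartOver_of_bsdp_twist_rankZero_semistable`, total rank `1`
by FILE E-3's `bsdp_of_pPartOver_of_bsdp_twist_rankOne_semistable`. `K` imaginary, `d_K` odd
squarefree, `p` odd; hypotheses `hGZK`, `hmod` only.
[cite: Milne1972ArithmeticAV, §1 Thm. 1 and §2 (through DokchitserDokchitserAnnals2010, §2.1, proof of Thm. 8)] -/
theorem bsdp_of_pPartOver_of_bsdp_twist_rankLeOne_semistable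
    (hGZK : rank_eq_analyticRank_of_analyticRank_le_one) (hmod : hasEntireLFunction_rat)
    (h2 : Module.finrank ℚ K = 2)
    (hdodd : Odd (NumberField.discr K)) (hdsq : Squarefree (NumberField.discr K))
    {Cd : VariableChange ℚ} (hWd : Cd • W.quadraticTwist (NumberField.discr K : ℚ) = Wd)
    {C' : VariableChange K} (hW' : C' • W.baseChange K = W')
    (hr : W.analyticRank + Wd.analyticRank ≤ 1)
    (hS : ∀ v : HeightOneSpectrum (𝓞 ℚ), W.HasGoodReductionAt v ∨ W.HasMultiplicativeReductionAt v ∨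
      (((primesEquiv v : ℕ) : ℤ) ∣ NumberField.discr K ∧ Wd.HasMultiplicativeReductionAt v))
    (hp2 : p ≠ 2) (hK : MissingPPartOverAt W' p) (hd : BSDp Wd p) : BSDp W p := by
  rcases Nat.eq_zero_or_pos (W.analyticRank + Wd.analyticRank) with h0 | hpos
  · exact bsdp_of_pPartOver_of_bsdp_twist_rankZero_semistable W p K Wd W' hGZK hmod h2 hdodd hdsq
      hWd hW' (by omega) (by omega) hS hp2 hK hd
  · have h1 : W.analyticRank + Wd.analyticRank = 1 := by omega
    exact bsdp_of_pPartOver_of_bsdp_twist_rankOne_semistable W p K Wd W' hGZK hmod h2 hdodd hdsq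
      hWd hW' h1 hS hp2 hK hd

/-- **The A65-free descent END on S₂ (`p ≥ 5`) in TOTAL ANALYTIC RANK `≤ 1`**: as
`bsdp_of_pPartOver_of_bsdp_twist_rankLeOne_semistable` with additive places of residue
characteristic `≥ 5` prime to `d_K` allowed (FILES D-2 / E-3, `…_or_addv`).
[cite: Milne1972ArithmeticAV, §1 Thm. 1 and §2 (through DokchitserDokchitserAnnals2010, §2.1, proof of Thm. 8)] -/
theorem bsdp_of_pPartOver_of_bsdp_twist_rankLeOne_semistable_or_addv
    (hGZK : rank_eq_analyticRank_of_analyticRank_le_one) (hmod : hasEntireLFunction_rat)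
    (h2 : Module.finrank ℚ K = 2)
    (hdodd : Odd (NumberField.discr K)) (hdsq : Squarefree (NumberField.discr K))
    {Cd : VariableChange ℚ} (hWd : Cd • W.quadraticTwist (NumberField.discr K : ℚ) = Wd)
    {C' : VariableChange K} (hW' : C' • W.baseChange K = W')
    (hr : W.analyticRank + Wd.analyticRank ≤ 1)
    (hS : ∀ v : HeightOneSpectrum (𝓞 ℚ), W.HasGoodReductionAt v ∨ W.HasMultiplicativeReductionAt v ∨
      (((primesEquiv v : ℕ) : ℤ) ∣ NumberField.discr K ∧ Wd.HasMultiplicativeReductionAt v) ∨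
      (W.HasAdditiveReductionAt v ∧ ¬ ((primesEquiv v : ℕ) : ℤ) ∣ NumberField.discr K ∧
        5 ≤ (primesEquiv v : ℕ)))
    (hp5 : 5 ≤ p) (hK : MissingPPartOverAt W' p) (hd : BSDp Wd p) : BSDp W p := by
  rcases Nat.eq_zero_or_pos (W.analyticRank + Wd.analyticRank) with h0 | hpos
  · exact bsdp_of_pPartOver_of_bsdp_twist_rankZero_semistable_or_addv W p K Wd W' hGZK hmod h2 hdodd
      hdsq hWd hW' (by omega) (by omega) hS hp5 hK hd
  · have h1 : W.analyticRank + Wd.analyticRank = 1 := by omega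
    exact bsdp_of_pPartOver_of_bsdp_twist_rankOne_semistable_or_addv W p K Wd W' hGZK hmod h2 hdodd
      hdsq hWd hW' h1 hS hp5 hK hd

end RankOneEnds

end Summit.BirchSwinnertonDyer.Rank1Residual.AdditivePotMult

end
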